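import Summits.CriticalPhenomena.PercolationContinuityZ3.Theorems.PercNearOneGluingNoHeavyLowerTailSahiC3CubeFour
import Summits.CriticalPhenomena.PercolationContinuityZ3.Theorems.PercNearOneGluingNoHeavyLowerTailSahiC3CubeLeThree
import Summits.CriticalPhenomena.PercolationContinuityZ3.Theorems.PercNearOneGluingNoHeavyLowerTailSahiC3CubeEvents
import Summits.CriticalPhenomena.PercolationContinuityZ3.Theorems.PercNearOneGluingNoHeavyLowerTailSahiThreeCopyNested
import Summits.CriticalPhenomena.PercolationContinuityZ3.Theorems.PercNearOneGluingNoHeavyLowerTailSahiThreeCopyCylinderSandwich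

/-!
# `NoHeavyLowerTail` (crux stmt-CriticalPhenomena-4575), Sahi programme: **3C-SAHI ON `{0,1}^m`, `m ≤ 4`, IS A LEAN THEOREM**
# — the bridge from the kernel-checked tensor-Bernstein certificates (`checkCube m σ`, generation 1) to the three-copy
# coefficient `c_b` of `…SahiThreeCopy`

Support file (Sahi cell, seat `prim-sahi-p1`, generation 55; `--supports stmt-CriticalPhenomena-4575`).

The census conjecture 3C-SAHI (`ThreeCopySahiSets`: `0 ≤ c_b(1_A,1_B,1_C)` for all up-sets `A, B, C ⊆ {0,1}^d` and all profiles
`b`; CENSUS §175 / W197, exhaustive outside Lean for `d ≤ 5`, CENSUS §190) is the induction BASE of the structural closure theorems of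
generations 53–55 (read-once closure `RO.good`, block products, literal adjunction, …), which so far could only be fed with the
structurally settled classes.  The kernel ALREADY checked every coefficient for `m ≤ 4`: the certificate checker
`SahiC3Cube.checkTriple` (generation 1, `…SahiC3CubeCertCheck`) passes exactly when all `4^m` tensor-Bernstein fibre sums
`cubicCoef` of Sahi's cubic are nonnegative (that is how `checkTriple_sound` concludes `E₃ ≥ 0` on `[0,1]^m`), and
`checkCube_zero … checkCube_four` (`decide` / `native_decide`, `…SahiC3CubeLeThree` / `…SahiC3CubeFour`) are in the tree — but
only the law-level conclusion `sahiC3_cube_four` was exported.  This file exports the COEFFICIENTS: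
* `cubicCoef_nonneg_of_checkTriple` — the digit test gives `0 ≤ cubicCoef … k` for every key `k` (the first half of
  `checkTriple_sound`, verbatim);
* `pcoef3_cast_eq_N3`, `cubicCoef_cast_eq_tc` — the fibre sums ARE the three-copy counts: `pcoef3 X Y Z k = N_k(X;Y;Z)` and
  `cubicCoef sgn5 X5 Y5 Z5 k = c_k(1_A,1_B,1_C)` for the bitmask tables (`key3 = profile`);
* `tc_tabR_nonneg_of_checkCube` — `checkCube m σ = true ⇒ 0 ≤ c_b(tabR A, tabR B, tabR C)` for all increasing bitmasks (any
  order, via `forall_of_sorted`) and every profile `b` (profiles with an entry `> 3` have no arrangements);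
* `evU`, `tabR_encA_evU`, `isUpperSet_evU` — every up-set `U ⊆ Pt m` (a finset of points) is the table of an increasing bitmask;
* **`tc_setInd_nonneg_of_checkCube`** and **`tc_setInd_nonneg_of_le_four`**: for `m ≤ 4`, all up-sets `A, B, C ⊆ {0,1}^m` and
  every profile `b`, `0 ≤ c_b(1_A,1_B,1_C)` — 3C-SAHI on the cubes of dimension `≤ 4` (`168³ · 4⁴` instances at `m = 4`), hence
  (`…ReadOnce`, `…Blocks`, `…BlockOr`, `…MixedLiterals`) for every common read-once composition of triples on `≤ 4`-variable blocks.
COMPUTATIONAL through `checkCube_four` (`native_decide`, generation 1); `m ≤ 3` is by kernel `decide`.  Nothing conjectural is used.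
[this work; certificates: this cell generation 1; census: CENSUS §175 W197]
-/

namespace Summit.CriticalPhenomena.PercolationContinuityZ3.Theorems.SahiThreeCopy

open Finset Function Literature.Combinatorics.Sahi2008
open Summit.CriticalPhenomena.PercolationContinuityZ3.Theorems.OneCutCert
open Summit.CriticalPhenomena.PercolationContinuityZ3.Theorems.CovTransferCert
open Summit.CriticalPhenomena.PercolationContinuityZ3.Theorems.SahiC3Cube
open Summit.CriticalPhenomena.PercolationContinuityZ3.Theorems.AdditiveGluing.Negative.Cert
open scoped BigOperators

noncomputable section

/-! ### §1 The digit test gives nonnegative tensor-Bernstein coefficients -/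

set_option maxHeartbeats 800000 in
/-- **`checkTriple ⇒ all fibre sums ≥ 0`**: if the digit test of the bitmask triple `(A,B,C)` passes in base `2^σ`, every
tensor-Bernstein coefficient `cubicCoef sgn5 X5 Y5 Z5 k` of Sahi's cubic is nonnegative.  (This is the first half of the proof of
`SahiC3Cube.checkTriple_sound`, exported.) [this work; certificates: this cell generation 1] -/
theorem cubicCoef_nonneg_of_checkTriple {σ m A B C : ℕ} (h : checkTriple σ m A B C = true) (k : Fin m → Fin 4) :
    0 ≤ cubicCoef sgn5 (X5 m A B C) (Y5 m A B C) (Z5 m C) k := by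
  unfold checkTriple checkTripleW at h
  simp only [Bool.and_eq_true, decide_eq_true_eq] at h
  obtain ⟨⟨hσ, hbnd⟩, hZ, hland⟩ := h
  have hoff : offT σ m = (maskN σ (4 ^ m) : ℤ) := by
    unfold offT
    rw [off_eq σ (4 ^ m) hσ, maskN_eq_sum σ hσ, Finset.mul_sum]
  rw [hoff] at hZ hland
  rw [Int.toNat_natCast] at hland
  have hZeq : zE3 σ m (krT σ m (fullN m)) A B C = cubicZ (2 ^ σ) sgn5 (X5 m A B C) (Y5 m A B C) (Z5 m C) := by
    unfold zE3 cubicZ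
    simp only [Fin.sum_univ_five, sgn5, X5, Y5, Z5, Matrix.cons_val_zero, Matrix.cons_val_one, Matrix.cons_val,
      krT_eq]
    ring
  have hB : CoefBound3 sgn5 (X5 m A B C) (Y5 m A B C) (Z5 m C) (2 ^ (σ - 1)) := by
    intro k
    have hX : ∀ j g, |X5 m A B C j g| ≤ 1 := by intro j g; fin_cases j <;> exact abs_tabZ_le _ _ _
    have hY : ∀ j g, |Y5 m A B C j g| ≤ 1 := by intro j g; fin_cases j <;> exact abs_tabZ_le _ _ _
    have hZ5 : ∀ j g, |Z5 m C j g| ≤ 1 := by intro j g; fin_cases j <;> exact abs_tabZ_le _ _ _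
    have h8 : ∀ j, |sgn5 j * pcoef3 (X5 m A B C j) (Y5 m A B C j) (Z5 m C j) k| ≤ |sgn5 j| * 8 ^ m := by
      intro j
      rw [abs_mul]
      exact mul_le_mul_of_nonneg_left (abs_pcoef3_le _ _ _ (hX j) (hY j) (hZ5 j) k) (abs_nonneg _)
    have hsum : |cubicCoef sgn5 (X5 m A B C) (Y5 m A B C) (Z5 m C) k| ≤ 6 * 8 ^ m := by
      unfold cubicCoef
      calc |∑ j : Fin 5, sgn5 j * pcoef3 (X5 m A B C j) (Y5 m A B C j) (Z5 m C j) k|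
          ≤ ∑ j : Fin 5, |sgn5 j * pcoef3 (X5 m A B C j) (Y5 m A B C j) (Z5 m C j) k| := Finset.abs_sum_le_sum_abs _ _
        _ ≤ ∑ j : Fin 5, |sgn5 j| * (8 : ℤ) ^ m := Finset.sum_le_sum fun j _ => h8 j
        _ = 6 * 8 ^ m := by simp [Fin.sum_univ_five, sgn5]; ring
    have hpow : (6 : ℤ) * 8 ^ m < (2 : ℕ) ^ (σ - 1) := by exact_mod_cast hbnd
    exact lt_of_le_of_lt hsum hpow
  set N : ℕ := (zE3 σ m (krT σ m (fullN m)) A B C + maskN σ (4 ^ m)).toNat with hN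
  have hNZ : (N : ℤ) = cubicZ (2 ^ σ) sgn5 (X5 m A B C) (Y5 m A B C) (Z5 m C) +
      ∑ j : Fin (4 ^ m), (2 : ℤ) ^ (σ - 1) * (2 ^ σ) ^ (j : ℕ) := by
    rw [hN, Int.toNat_of_nonneg hZ, hZeq, maskN_eq_sum σ hσ, Fin.sum_univ_eq_sum_range
      (fun j => (2 : ℤ) ^ (σ - 1) * (2 ^ σ) ^ j) (4 ^ m)]
  have hdig : ∀ j : ℕ, j < 4 ^ m → 2 ^ (σ - 1) ≤ digit (2 ^ σ) N j := digit_ge_of_land σ hσ (4 ^ m) N hland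
  exact cubicCoef_nonneg_of_digit_ge hσ hB N hNZ hdig k

/-! ### §2 Fibre sums are three-copy counts -/

/-- The certificate key of three corners is their profile. [this work] -/
theorem key3_eq_profile {m : ℕ} (g h l : Fin m → Bool) : key3 g h l = profile g h l := rfl

/-- `key3 g h l = k` iff `(g,h,l)` is an arrangement of the profile `k`. [this work] -/
theorem key3_eq_iff_isArr {m : ℕ} (k : Fin m → Fin 4) (g h l : Fin m → Bool) :
    key3 g h l = k ↔ IsArr (fun i => ((k i : Fin 4) : ℕ)) g h l := by
  rw [key3_eq_profile, isArr_coe_iff]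

/-- **`pcoef3 = N3`**: the integer fibre sum of key `k` of three tables is the three-copy count `N_k` of the (cast) tables. [this work] -/
theorem pcoef3_cast_eq_N3 {m : ℕ} (X Y Z : (Fin m → Bool) → ℤ) (k : Fin m → Fin 4) :
    ((pcoef3 X Y Z k : ℤ) : ℝ) =
      N3 (fun i => ((k i : Fin 4) : ℕ)) (fun g => (X g : ℝ)) (fun g => (Y g : ℝ)) (fun g => (Z g : ℝ)) := by
  unfold pcoef3 N3
  push_cast
  refine Finset.sum_congr rfl fun g _ => Finset.sum_congr rfl fun h _ => Finset.sum_congr rfl fun l _ => ?_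
  rw [if_congr (key3_eq_iff_isArr k g h l) rfl rfl]

/-- Specialisation to bitmask tables: `pcoef3 (tabZ T₁) (tabZ T₂) (tabZ T₃) k = N_k(tabR T₁; tabR T₂; tabR T₃)`. [this work] -/
theorem pcoef3_tabZ_eq_N3 (m T₁ T₂ T₃ : ℕ) (k : Fin m → Fin 4) :
    ((pcoef3 (tabZ m T₁) (tabZ m T₂) (tabZ m T₃) k : ℤ) : ℝ) =
      N3 (fun i => ((k i : Fin 4) : ℕ)) (tabR m T₁) (tabR m T₂) (tabR m T₃) :=
  pcoef3_cast_eq_N3 _ _ _ k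

/-- Tables of intersections multiply. [this work] -/
theorem tabR_land_mul (m A B : ℕ) : tabR m (A &&& B) = tabR m A * tabR m B := by
  rw [tabR_land]; rfl

/-- The table of the full cube is `1`. [this work] -/
theorem tabR_fullN_eq_one (m : ℕ) : tabR m (fullN m) = (1 : (Fin m → Bool) → ℝ) := by
  funext g; simp [tabR, tabZ_fullN]

/-- **`cubicCoef = c_b`**: the tensor-Bernstein coefficient of key `k` of Sahi's cubic for the bitmask triple `(A,B,C)` is the
three-copy Sahi coefficient `c_k(tabR A, tabR B, tabR C)`. [this work] -/
theorem cubicCoef_cast_eq_tc (m A B C : ℕ) (k : Fin m → Fin 4) :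
    ((cubicCoef sgn5 (X5 m A B C) (Y5 m A B C) (Z5 m C) k : ℤ) : ℝ) =
      tc (fun i => ((k i : Fin 4) : ℕ)) (tabR m A) (tabR m B) (tabR m C) := by
  have h5 : ((cubicCoef sgn5 (X5 m A B C) (Y5 m A B C) (Z5 m C) k : ℤ) : ℝ) =
      2 * ((pcoef3 (tabZ m (A &&& B &&& C)) (tabZ m (fullN m)) (tabZ m (fullN m)) k : ℤ) : ℝ)
      + ((pcoef3 (tabZ m A) (tabZ m B) (tabZ m C) k : ℤ) : ℝ)
      - ((pcoef3 (tabZ m A) (tabZ m (B &&& C)) (tabZ m (fullN m)) k : ℤ) : ℝ)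
      - ((pcoef3 (tabZ m B) (tabZ m (A &&& C)) (tabZ m (fullN m)) k : ℤ) : ℝ)
      - ((pcoef3 (tabZ m C) (tabZ m (A &&& B)) (tabZ m (fullN m)) k : ℤ) : ℝ) := by
    unfold cubicCoef
    simp only [Fin.sum_univ_five, sgn5, X5, Y5, Z5, Matrix.cons_val_zero, Matrix.cons_val_one, Matrix.cons_val]
    push_cast
    ring
  rw [h5, pcoef3_tabZ_eq_N3, pcoef3_tabZ_eq_N3, pcoef3_tabZ_eq_N3, pcoef3_tabZ_eq_N3, pcoef3_tabZ_eq_N3]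
  simp only [tabR_land_mul, tabR_fullN_eq_one]
  unfold tc
  rw [N3_comm12 _ (tabR m C) (tabR m A * tabR m B) 1]
  ring_nf

/-! ### §3 From the cube check to `c_b ≥ 0` on tables of increasing bitmasks -/

/-- A passing digit test gives `0 ≤ c_k(tabR A, tabR B, tabR C)` for every key `k`. [this work] -/
theorem tc_tabR_nonneg_of_checkTriple {σ m A B C : ℕ} (h : checkTriple σ m A B C = true) (k : Fin m → Fin 4) :
    0 ≤ tc (fun i => ((k i : Fin 4) : ℕ)) (tabR m A) (tabR m B) (tabR m C) := by
  rw [← cubicCoef_cast_eq_tc]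
  exact_mod_cast cubicCoef_nonneg_of_checkTriple h k

/-- Every profile either has an entry `> 3` (then `c_b = 0`) or is a key `k : Fin m → Fin 4`. [this work] -/
theorem tc_nonneg_of_forall_key {m : ℕ} (f g h : Pt m → ℝ)
    (H : ∀ k : Fin m → Fin 4, 0 ≤ tc (fun i => ((k i : Fin 4) : ℕ)) f g h) (b : Fin m → ℕ) : 0 ≤ tc b f g h := by
  by_cases hb : ∃ i, 3 < b i
  · obtain ⟨i, hi⟩ := hb
    rw [tc_eq_zero_of_three_lt hi]
  · simp only [not_exists, not_lt] at hb
    have e : b = fun i => (((⟨b i, Nat.lt_succ_of_le (hb i)⟩ : Fin 4) : Fin 4) : ℕ) := by funext i; rfl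
    rw [e]
    exact H _

/-- **The cube check certifies 3C-SAHI on all tables of increasing bitmasks**, in any order and at every profile. [this work] -/
theorem tc_tabR_nonneg_of_checkCube {m σ : ℕ} (h : checkCube m σ = true) {A B C : ℕ} (hA : A ∈ upsN m) (hB : B ∈ upsN m)
    (hC : C ∈ upsN m) (b : Fin m → ℕ) : 0 ≤ tc b (tabR m A) (tabR m B) (tabR m C) := by
  let P : {T : ℕ // T ∈ upsN m} → {T : ℕ // T ∈ upsN m} → {T : ℕ // T ∈ upsN m} → Prop :=
    fun x y z => ∀ b : Fin m → ℕ, 0 ≤ tc b (tabR m x.1) (tabR m y.1) (tabR m z.1)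
  have key : P ⟨A, hA⟩ ⟨B, hB⟩ ⟨C, hC⟩ := by
    refine forall_of_sorted P (fun x => x.1) ?_ ?_ ?_ ⟨A, hA⟩ ⟨B, hB⟩ ⟨C, hC⟩
    · intro x y z hxyz b'; have := hxyz b'; rwa [tc_comm12]
    · intro x y z hxyz b'; have := hxyz b'; rwa [tc_comm23]
    · intro x y z hxy hyz
      exact tc_nonneg_of_forall_key _ _ _ fun k =>
        tc_tabR_nonneg_of_checkTriple (checkTriple_of_checkCube h x.2 y.2 z.2 hxy hyz) k
  exact key b

/-! ### §4 Every up-set of points is the table of an increasing bitmask -/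

/-- The coordinate-set event of a finset of points: `{ {i | g i} : g ∈ U }`. [this work] -/
def evU {m : ℕ} (U : Finset (Pt m)) : Set (Set (Fin m)) := {S | ∃ g ∈ U, S = {i | g i = true}}

/-- A point is recovered from its coordinate set. [this work] -/
theorem eq_of_setOf_eq {m : ℕ} {g g' : Pt m} (h : {i | g i = true} = {i | g' i = true}) : g = g' := by
  funext i
  have := Set.ext_iff.1 h i
  simp only [Set.mem_setOf_eq] at this
  cases hg : g i <;> cases hg' : g' i
  · rfl
  · rw [hg, hg'] at this; simp at this
  · rw [hg, hg'] at this; simp at this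
  · rfl

/-- Membership of a coordinate set in `evU U` is membership of the point in `U`. [this work] -/
theorem setOf_mem_evU {m : ℕ} (U : Finset (Pt m)) (g : Pt m) : {i | g i = true} ∈ evU U ↔ g ∈ U := by
  constructor
  · rintro ⟨g', hg', hgg'⟩
    rw [eq_of_setOf_eq hgg']; exact hg'
  · intro hg; exact ⟨g, hg, rfl⟩

/-- The bitmask of `evU U` has table `1_U`. [this work] -/
theorem tabR_encA_evU {m : ℕ} (U : Finset (Pt m)) : tabR m (encA m (evU U)) = setInd U := by
  classical
  funext g
  simp only [tabR, tabZ_encA, setInd_apply]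
  by_cases hg : g ∈ U
  · rw [if_pos ((setOf_mem_evU U g).2 hg), if_pos hg]; simp
  · rw [if_neg (fun h => hg ((setOf_mem_evU U g).1 h)), if_neg hg]; simp

/-- An up-set of points gives an increasing coordinate-set event. [this work] -/
theorem isUpperSet_evU {m : ℕ} {U : Finset (Pt m)} (hU : IsUpperSet (U : Set (Pt m))) : IsUpperSet (evU U) := by
  classical
  intro S S' hSS' hS
  obtain ⟨g, hg, rfl⟩ := hS
  let g' : Pt m := fun i => decide (i ∈ S')
  have hgg' : g ≤ g' := by
    intro i
    cases hgi : g i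
    · exact Bool.false_le _
    · have : i ∈ S' := hSS' (by simpa using hgi)
      show true ≤ decide (i ∈ S')
      rw [decide_eq_true this]
  have hg'U : g' ∈ U := hU hgg' hg
  refine ⟨g', hg'U, ?_⟩
  ext i
  simp [g']

/-- The bitmask of an up-set of points is listed in `upsN`. [this work] -/
theorem encA_evU_mem_upsN {m : ℕ} {U : Finset (Pt m)} (hU : IsUpperSet (U : Set (Pt m))) : encA m (evU U) ∈ upsN m :=
  encA_mem_upsN (isUpperSet_evU hU)

/-! ### §5 3C-SAHI on the cubes of dimension `≤ 4` -/

/-- **`checkCube m σ = true ⇒ 3C-SAHI on `{0,1}^m`**: for all up-sets `A, B, C ⊆ Pt m` and every profile `b`,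
`0 ≤ c_b(1_A,1_B,1_C)`. [this work] -/
theorem tc_setInd_nonneg_of_checkCube {m σ : ℕ} (h : checkCube m σ = true) (b : Fin m → ℕ) {A B C : Finset (Pt m)}
    (hA : IsUpperSet (A : Set (Pt m))) (hB : IsUpperSet (B : Set (Pt m))) (hC : IsUpperSet (C : Set (Pt m))) :
    0 ≤ tc b (setInd A) (setInd B) (setInd C) := by
  rw [← tabR_encA_evU A, ← tabR_encA_evU B, ← tabR_encA_evU C]
  exact tc_tabR_nonneg_of_checkCube h (encA_evU_mem_upsN hA) (encA_evU_mem_upsN hB) (encA_evU_mem_upsN hC) b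

/-- For every `m ≤ 4` some cube check is in the tree (`decide` for `m ≤ 3`, `native_decide` for `m = 4`). [this work] -/
theorem exists_checkCube_of_le_four {m : ℕ} (hm : m ≤ 4) : ∃ σ, checkCube m σ = true := by
  interval_cases m
  · exact ⟨4, checkCube_zero⟩
  · exact ⟨7, checkCube_one⟩
  · exact ⟨10, checkCube_two⟩
  · exact ⟨13, checkCube_three⟩
  · exact ⟨16, checkCube_four⟩

/-- **3C-SAHI ON `{0,1}^m` FOR `m ≤ 4`** (census conjecture CENSUS §175 / W197, restricted to dimension `≤ 4`): for all up-sets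
`A, B, C ⊆ {0,1}^m` and EVERY profile `b`, the three-copy Sahi coefficient is nonnegative, `0 ≤ c_b(1_A,1_B,1_C)`.
Computational (through `checkCube_four`, `native_decide`). [this work] -/
theorem tc_setInd_nonneg_of_le_four {m : ℕ} (hm : m ≤ 4) (b : Fin m → ℕ) {A B C : Finset (Pt m)}
    (hA : IsUpperSet (A : Set (Pt m))) (hB : IsUpperSet (B : Set (Pt m))) (hC : IsUpperSet (C : Set (Pt m))) :
    0 ≤ tc b (setInd A) (setInd B) (setInd C) := by
  obtain ⟨σ, hσ⟩ := exists_checkCube_of_le_four hm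
  exact tc_setInd_nonneg_of_checkCube hσ b hA hB hC

/-- Functions form on `{0,1}^m`, `m ≤ 4`: `0 ≤ c_b(f,g,h)` for all nonnegative monotone `f, g, h` (layer cake in each slot). [this work] -/
theorem tc_nonneg_of_le_four {m : ℕ} (hm : m ≤ 4) (b : Fin m → ℕ) {f g h : Pt m → ℝ} (hf : ∀ x, 0 ≤ f x)
    (hg : ∀ x, 0 ≤ g x) (hh : ∀ x, 0 ≤ h x) (hfm : Monotone f) (hgm : Monotone g) (hhm : Monotone h) :
    0 ≤ tc b f g h := by
  refine tc_nonneg_of_forall_setInd_left b g h hf hfm fun U hU => ?_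
  rw [tc_comm12]
  refine tc_nonneg_of_forall_setInd_left b (setInd U) h hg hgm fun V hV => ?_
  rw [tc_comm23, tc_comm12]
  refine tc_nonneg_of_forall_setInd_left b (setInd V) (setInd U) hh hhm fun W hW => ?_
  exact tc_setInd_nonneg_of_le_four hm b hW hV hU

/-- The kernel-`decide` part alone: 3C-SAHI on `{0,1}^m` for `m ≤ 3` without `native_decide`. [this work] -/
theorem tc_setInd_nonneg_of_le_three {m : ℕ} (hm : m ≤ 3) (b : Fin m → ℕ) {A B C : Finset (Pt m)}
    (hA : IsUpperSet (A : Set (Pt m))) (hB : IsUpperSet (B : Set (Pt m))) (hC : IsUpperSet (C : Set (Pt m))) :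
    0 ≤ tc b (setInd A) (setInd B) (setInd C) := by
  have : ∃ σ, checkCube m σ = true := by
    interval_cases m
    · exact ⟨4, checkCube_zero⟩
    · exact ⟨7, checkCube_one⟩
    · exact ⟨10, checkCube_two⟩
    · exact ⟨13, checkCube_three⟩
  obtain ⟨σ, hσ⟩ := this
  exact tc_setInd_nonneg_of_checkCube hσ b hA hB hC

end

end Summit.CriticalPhenomena.PercolationContinuityZ3.Theorems.SahiThreeCopy
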